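import Literature.GroupTheory.Transfer.TransferTransitivity
import HarnessLib

/-!
# The transfer commutes with quotient maps: `Ver_{Ḡ→H̄}(π g) = Ver_{G→H}(g)` read through `π|_H`
# (Serre, *Local Fields* VII §8 Prop. 7, naturality of the explicit formula)

Topic `GroupTheory/Transfer`; namespace `Literature.GroupTheory.Transfer`.  Mathlib + the tree's
`TransferTransitivity.lean` (Serre's section formula `transfer_eq_prod_section`); theorems only, no
named fact.

For a surjective homomorphism `π : G → Ḡ` whose kernel lies in the finite-index subgroup `H`
(so `Ḡ/π(H) ≅ G/H`), and `ϕ̄ : π(H) → A` into a commutative group: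
**`transfer_apply_map_of_surjective`** — `Ver_{Ḡ, π(H)}(ϕ̄)(π g) = Ver_{G, H}(ϕ̄ ∘ π|_H)(g)`.
Proof: a section `ρ` of `G → G/H` pushes forward to the section `π ∘ ρ` of `Ḡ → Ḡ/π(H)` along the
bijection `G/H ≅ Ḡ/π(H)`, and the factors `ρ(gq)⁻¹ g ρ(q)` of Serre's formula ("the transfer is
obtained by passing to the quotient the map `s → ∏_t x_{t,s}`", VII §8 Prop. 7) map to the
corresponding factors for `π g`.  Used to compare the Verlagerung between open subgroups of a
profinite group with the transfer of its finite quotients (local class field theory, Neukirch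
IV (5.9); abc-iut layer L4, [AbsTopIII] Cor. 1.10 (i)).

## References
* J.-P. Serre, *Local Fields*, GTM 67, Springer (1979), VII §8 Prop. 7. [Serre1979]
-/

noncomputable section

open scoped Pointwise

namespace Literature.GroupTheory.Transfer

open MulAction

variable {G : Type*} [Group G] {G' : Type*} [Group G'] {A : Type*} [CommGroup A] {H : Subgroup G}

/-- For `π : G → Ḡ` with `ker π ≤ H`: `π a` and `π b` define the same coset of `π(H)` iff `a`, `b`
define the same coset of `H`. [folklore] -/
private theorem map_mk_eq_iff (π : G →* G') (hker : π.ker ≤ H) (a b : G) :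
    ((π a : G') : G' ⧸ H.map π) = (π b : G' ⧸ H.map π) ↔ (a : G ⧸ H) = (b : G ⧸ H) := by
  rw [QuotientGroup.eq, QuotientGroup.eq]
  constructor
  · rintro ⟨h, hh, hπ⟩
    have : a⁻¹ * b * h⁻¹ ∈ π.ker := by
      rw [MonoidHom.mem_ker, map_mul, map_inv, map_mul, map_inv, hπ, mul_inv_cancel]
    have h2 := H.mul_mem (hker this) hh
    rwa [inv_mul_cancel_right] at h2
  · intro h
    exact ⟨a⁻¹ * b, h, by rw [map_mul, map_inv]⟩

/-- The image of a finite-index subgroup under a surjection with kernel inside it has finite index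
(indeed the same index). [folklore] -/
private theorem finiteIndex_map_of_surjective (π : G →* G') (hπ : Function.Surjective π) (hker : π.ker ≤ H)
    [H.FiniteIndex] : (H.map π).FiniteIndex :=
  ⟨by rw [H.index_map_eq hπ hker]; exact Subgroup.FiniteIndex.index_ne_zero⟩

/-- **The transfer commutes with quotient maps** (naturality of Serre VII §8 Prop. 7): for a
surjective `π : G → Ḡ` with `ker π ≤ H`, `H` of finite index, and `ϕ̄ : π(H) → A`,
`Ver_{Ḡ, π(H)}(ϕ̄)(π g) = Ver_{G, H}(ϕ̄ ∘ π|_H)(g)`. [cite: Serre1979, VII §8 Prop. 7] -/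
theorem transfer_apply_map_of_surjective (π : G →* G') (hπ : Function.Surjective π)
    (hker : π.ker ≤ H) [H.FiniteIndex] (ϕ : H.map π →* A) (g : G) :
    haveI := finiteIndex_map_of_surjective π hπ hker
    MonoidHom.transfer ϕ (π g) = MonoidHom.transfer (ϕ.comp (π.subgroupMap H)) g := by
  classical
  haveI := finiteIndex_map_of_surjective π hπ hker
  letI := H.fintypeQuotientOfFiniteIndex
  letI := (H.map π).fintypeQuotientOfFiniteIndex
  -- the bijection `G/H ≅ Ḡ/π(H)` induced by `π`
  let fwd : G ⧸ H → G' ⧸ H.map π := Quotient.map' π fun a b hab => by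
    rw [QuotientGroup.leftRel_apply] at hab ⊢
    exact ⟨a⁻¹ * b, hab, by rw [map_mul, map_inv]⟩
  have hfwd : ∀ a : G, fwd (a : G ⧸ H) = (π a : G' ⧸ H.map π) := fun a => rfl
  have hinj : Function.Injective fwd := by
    intro x y hxy
    induction x using QuotientGroup.induction_on with
    | H a =>
      induction y using QuotientGroup.induction_on with
      | H b => exact (map_mk_eq_iff π hker a b).mp (by rwa [hfwd, hfwd] at hxy)
  have hsurj : Function.Surjective fwd := by
    intro y
    induction y using QuotientGroup.induction_on with
    | H b =>
      obtain ⟨a, rfl⟩ := hπ b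
      exact ⟨(a : G ⧸ H), hfwd a⟩
  let β : G ⧸ H ≃ G' ⧸ H.map π := Equiv.ofBijective fwd ⟨hinj, hsurj⟩
  have hβ : ∀ a : G, β (a : G ⧸ H) = (π a : G' ⧸ H.map π) := fun a => rfl
  have hβsmul : ∀ (a : G) (q : G ⧸ H), β (a • q) = π a • β q := by
    intro a q
    induction q using QuotientGroup.induction_on with
    | H b => rw [MulAction.Quotient.smul_coe, smul_eq_mul, hβ, hβ, MulAction.Quotient.smul_coe,
        smul_eq_mul, map_mul]
  -- sections: `ρ` of `G → G/H` and `π ∘ ρ ∘ β⁻¹` of `Ḡ → Ḡ/π(H)`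
  have hρ : ∀ q : G ⧸ H, ((Quotient.out q : G) : G ⧸ H) = q := Quotient.out_eq
  have hρ' : ∀ q' : G' ⧸ H.map π, ((π (Quotient.out (β.symm q')) : G') : G' ⧸ H.map π) = q' := by
    intro q'
    rw [← hβ, hρ, Equiv.apply_symm_apply]
  rw [transfer_eq_prod_section ϕ hρ' (π g), transfer_eq_prod_section (ϕ.comp (π.subgroupMap H)) hρ g]
  -- reindex along `β`
  refine Fintype.prod_equiv β.symm _ _ fun q' => ?_
  rw [MonoidHom.comp_apply]
  congr 1
  apply Subtype.ext
  change (π (Quotient.out (β.symm (π g • q'))))⁻¹ * π g * π (Quotient.out (β.symm q')) =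
    π ((Quotient.out (g • β.symm q'))⁻¹ * g * Quotient.out (β.symm q'))
  have hq : β.symm (π g • q') = g • β.symm q' := by
    apply β.injective
    rw [Equiv.apply_symm_apply, hβsmul, Equiv.apply_symm_apply]
  rw [map_mul, map_mul, map_inv, hq]

end Literature.GroupTheory.Transfer
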